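import Literature.Probability.RandomPlanarGeometry.SAWTubeLocality
import Literature.Probability.RandomPlanarGeometry.HammersleyWelshSharp
import Mathlib.Analysis.SpecialFunctions.Pow.Asymptotics
import Mathlib.Analysis.Real.Pi.Bounds
import HarnessLib

/-!
# Locality of `μ` in tubes and slabs: the rate with the sharp Hammersley–Welsh constant,
# `log μ - log μ(R[k,T]) ≤ (2π√(2/3) + η) T^{-1/2}` for `T ≥ T₀(η)`

Topic `Literature/Probability/RandomPlanarGeometry` (continues `SAWTubeLocality.lean`). The scheme of
`SAWTubeLocality.lean` (Madras–Slade Theorem 8.2.1, (8.2.12), quantified): bridges of length `N`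
concatenated inside `R[k,4N]` give `μ(R[k,4N]) ≥ B^{1/N}` with `b_N ≤ #offsets · B`, and a
Hammersley–Welsh bound converts `b_N` into `μ^{N-1}`. There the crude `c_{N-1} ≤ N e^{6√N} b_N`
(`count_le_mul_exp_mul_bridgeCount`) gives the all-`T` constant `(4 log μ + 8d + 32)/√T`
(`51.9/√T`, resp. `45/√T`, on `ℤ²`). Here the same scheme is run with the SHARP Hammersley–Welsh
lemma `c_{N-1} ≤ N e^{π√(2N/3)} b_N` (`count_le_sharp_mul_bridgeCount`, Madras–Slade (3.1.7) with
the Hardy–Ramanujan order `π(2/3)^{1/2}`, `HammersleyWelshSharp.lean`):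

* `log_sub_log_tubeConnectiveConstant_four_mul_le_sharp` — for `N ≥ 1`,
  `log μ - log μ(R[k,4N]) ≤ (log μ + π√(2N/3) + log N + log #offsets)/N`;
* **`log_sub_log_tubeConnectiveConstant_le_sharp`** — for every `T ≥ 4` (all `d ≥ 1`, `k ≥ 1`):
  `log μ - log μ(R[k,T]) ≤ 2π√(2/3)/√(T-3) + 4(log μ + (d+1) log T)/(T-3)`;
* **`eventually_log_sub_log_tubeConnectiveConstant_le`** — for every `η > 0`, eventually in `T`:
  `log μ - log μ(R[k,T]) ≤ (2π√(2/3) + η)/√T` (leading constant `2π√(2/3) = 5.1302…`, against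
  `51.9` in `SAWTubeLocality.lean`);
* `log_sub_log_stripConnectiveConstant_le_sharp` — the planar strip (`d = 2`, `k = 1`), all `T ≥ 4`:
  `log μ(ℤ²) - log μ(R[1,T]) ≤ 5.1303/√(T-3) + (8 log T + 4.8)/(T-3)`.

The exponent `1/2` is that of the bridge scheme; only the constant is improved here.
-/

noncomputable section

open Filter Topology Asymptotics Literature.Probability.LatticeModels Literature.Probability.Percolation
  SimpleGraph
open scoped BigOperators

namespace Literature.Probability.RandomPlanarGeometry.SAW.Zd

variable {d : ℕ}

section Rate

variable [NeZero d] {k : ℕ}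

/-- **The rate at width `4N` with the sharp Hammersley–Welsh constant**: for `N ≥ 1`,
`log μ - log μ(R[k,4N]) ≤ (log μ + π√(2N/3) + log N + log #offsets)/N`. Ingredients:
`μ(R[k,4N]) ≥ B^{1/N}`, `b_N ≤ #offsets · B` (`exists_pow_le_tubeCount`) and
`μ^{N-1} ≤ c_{N-1} ≤ N e^{π√(2N/3)} b_N` (`count_le_sharp_mul_bridgeCount`).
[cite: MadrasSlade1993, Theorem 8.2.1, eq. (8.2.12); §3.1 eq. (3.1.7)] -/
theorem log_sub_log_tubeConnectiveConstant_four_mul_le_sharp (hk : 1 ≤ k) {N : ℕ} (hN : 1 ≤ N) :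
    Real.log (connectiveConstant d) - Real.log (tubeConnectiveConstant d k (4 * N)) ≤
      (Real.log (connectiveConstant d) + Real.pi * Real.sqrt (2 * N / 3) + Real.log N +
        Real.log ((tubeOffsets d k N).card)) / N := by
  obtain ⟨B, hbB, hB⟩ := exists_pow_le_tubeCount (d := d) hk N
  set μ := connectiveConstant d with hμdef
  set P : ℝ := ((tubeOffsets d k N).card : ℝ) with hPdef
  have hμ : 0 < μ := connectiveConstant_pos d
  have hP : 1 ≤ P := by rw [hPdef]; exact_mod_cast one_le_card_tubeOffsets d k N
  -- `μ^{N-1} ≤ c_{N-1} ≤ N e^{π√(2N/3)} b_N ≤ N e^{π√(2N/3)} P B`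
  obtain ⟨n, rfl⟩ : ∃ n, N = n + 1 := ⟨N - 1, by omega⟩
  have h1 : μ ^ n ≤ ((n : ℝ) + 1) * Real.exp (Real.pi * Real.sqrt (2 * (n + 1) / 3)) *
      bridgeCount d (n + 1) :=
    (pow_connectiveConstant_le_count d n).trans (count_le_sharp_mul_bridgeCount n)
  have h2 : (bridgeCount d (n + 1) : ℝ) ≤ P * B := by rw [hPdef]; exact_mod_cast hbB
  have hBpos : (0 : ℝ) < B := by
    have : (0 : ℝ) < bridgeCount d (n + 1) := by exact_mod_cast one_le_bridgeCount (d := d) (n + 1)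
    have hP0 : 0 < P := by linarith
    nlinarith [this, h2, hP0]
  have h3 : μ ^ n ≤ ((n : ℝ) + 1) * Real.exp (Real.pi * Real.sqrt (2 * (n + 1) / 3)) * (P * B) :=
    h1.trans (mul_le_mul_of_nonneg_left h2 (by positivity))
  -- `B^{1/N} ≤ μ(R[k,4N])`
  have hn1 : (0 : ℝ) < (n : ℝ) + 1 := by positivity
  have h4 : (B : ℝ) ^ (1 / ((n : ℝ) + 1)) ≤ tubeConnectiveConstant d k (4 * (n + 1)) := by
    have h := rpow_le_tubeConnectiveConstant (d := d) hk (T := 4 * (n + 1)) (M := 2 * (n + 1))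
      (B := B ^ 2) (by omega) (fun j => by rw [← pow_mul]; exact hB j)
    have e : ((B ^ 2 : ℕ) : ℝ) ^ (1 / ((2 * (n + 1) : ℕ) : ℝ)) = (B : ℝ) ^ (1 / ((n : ℝ) + 1)) := by
      push_cast
      rw [← Real.rpow_natCast (B : ℝ) 2, ← Real.rpow_mul hBpos.le]
      congr 1
      push_cast
      field_simp
    rwa [e] at h
  -- take logarithms
  have hT : 0 < tubeConnectiveConstant d k (4 * (n + 1)) := tubeConnectiveConstant_pos hk _
  have hlog4 : Real.log B ≤ ((n : ℝ) + 1) * Real.log (tubeConnectiveConstant d k (4 * (n + 1))) := by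
    have h := Real.log_le_log (Real.rpow_pos_of_pos hBpos _) h4
    rw [Real.log_rpow hBpos] at h
    have h' := mul_le_mul_of_nonneg_left h hn1.le
    rwa [← mul_assoc, mul_one_div_cancel hn1.ne', one_mul] at h'
  have hlog3 : (n : ℝ) * Real.log μ ≤
      Real.log ((n : ℝ) + 1) + Real.pi * Real.sqrt (2 * (n + 1) / 3) + Real.log P + Real.log B := by
    have := Real.log_le_log (pow_pos hμ n) h3
    rw [Real.log_pow, Real.log_mul (by positivity) (by positivity),
      Real.log_mul (by positivity) (by positivity), Real.log_exp,
      Real.log_mul (by positivity) hBpos.ne'] at this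
    linarith
  push_cast
  rw [le_div_iff₀ hn1]
  nlinarith [hlog3, hlog4, Real.log_nonneg hP]

/-- `2π√(2/3) = 5.1302… ≤ 5.1303`. [folklore] -/
private theorem two_pi_sqrt_two_thirds_le : 2 * Real.pi * Real.sqrt (2 / 3) ≤ 5.1303 := by
  have hπ := Real.pi_lt_d6
  have hs : Real.sqrt (2 / 3) < 0.81649659 := by
    rw [Real.sqrt_lt' (by norm_num)]; norm_num
  nlinarith [Real.pi_pos, Real.sqrt_nonneg (2 / 3 : ℝ)]

/-- **Locality of `μ` in tubes and slabs, sharp-constant two-term form**: for `d ≥ 1`, `1 ≤ k` and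
every `T ≥ 4`,
`log μ - log μ(R[k,T]) ≤ 2π√(2/3)/√(T-3) + 4 (log μ + (d+1) log T)/(T-3)`.
[cite: MadrasSlade1993, Theorem 8.2.1, eq. (8.2.12); §3.1 eq. (3.1.7)] -/
theorem log_sub_log_tubeConnectiveConstant_le_sharp (hk : 1 ≤ k) {T : ℕ} (hT : 4 ≤ T) :
    Real.log (connectiveConstant d) - Real.log (tubeConnectiveConstant d k T) ≤
      2 * Real.pi * Real.sqrt (2 / 3) / Real.sqrt ((T : ℝ) - 3) +
        4 * (Real.log (connectiveConstant d) + ((d : ℝ) + 1) * Real.log T) / ((T : ℝ) - 3) := by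
  set μ := connectiveConstant d with hμdef
  have hμ1 : 1 ≤ μ := one_le_connectiveConstant d
  have hlogμ : 0 ≤ Real.log μ := Real.log_nonneg hμ1
  set N := T / 4 with hNdef
  have hN1 : 1 ≤ N := by omega
  have h4N : 4 * N ≤ T := by omega
  have hT43 : T ≤ 4 * N + 3 := by omega
  have hNr : (1 : ℝ) ≤ N := by exact_mod_cast hN1
  have hTr : (4 : ℝ) ≤ T := by exact_mod_cast hT
  have hT3 : (0 : ℝ) < (T : ℝ) - 3 := by linarith
  have hT3N : (T : ℝ) - 3 ≤ 4 * N := by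
    have : (T : ℝ) ≤ 4 * N + 3 := by exact_mod_cast hT43
    linarith
  have hNT : (N : ℝ) ≤ T := by exact_mod_cast (show N ≤ T by omega)
  have h2N1T : (2 * (N : ℝ) + 1) ≤ T := by exact_mod_cast (show 2 * N + 1 ≤ T by omega)
  -- monotonicity in the width and the rate at width `4N`
  have hmono' : Real.log (tubeConnectiveConstant d k (4 * N)) ≤
      Real.log (tubeConnectiveConstant d k T) :=
    Real.log_le_log (tubeConnectiveConstant_pos hk _) (tubeConnectiveConstant_mono k h4N)
  have hrate := log_sub_log_tubeConnectiveConstant_four_mul_le_sharp (d := d) hk hN1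
  -- the pieces
  have hsN0 : 0 < Real.sqrt N := Real.sqrt_pos.2 (by linarith)
  have hNsq : (N : ℝ) = Real.sqrt N * Real.sqrt N := (Real.mul_self_sqrt (by linarith)).symm
  have hsqrt : Real.sqrt (2 * N / 3) = Real.sqrt (2 / 3) * Real.sqrt N := by
    rw [← Real.sqrt_mul (by norm_num)]; congr 1; ring
  have hP : Real.log ((tubeOffsets d k N).card : ℝ) ≤ d * Real.log T := by
    have h1 : ((tubeOffsets d k N).card : ℝ) ≤ (2 * N + 1 : ℝ) ^ d := by
      exact_mod_cast card_tubeOffsets_le d k N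
    have h2 := Real.log_le_log (by exact_mod_cast one_le_card_tubeOffsets d k N) h1
    rw [Real.log_pow] at h2
    have h3 : Real.log (2 * N + 1 : ℝ) ≤ Real.log T := Real.log_le_log (by linarith) h2N1T
    have hd : (0 : ℝ) ≤ d := Nat.cast_nonneg d
    nlinarith
  have hlogN : Real.log N ≤ Real.log T := Real.log_le_log (by linarith) hNT
  have hlogT : 0 ≤ Real.log T := Real.log_nonneg (by linarith)
  -- `1/√N ≤ 2/√(T-3)` and `1/N ≤ 4/(T-3)`
  have hs1 : Real.sqrt ((T : ℝ) - 3) ≤ 2 * Real.sqrt N := by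
    rw [show (2 : ℝ) * Real.sqrt N = Real.sqrt (4 * N) by
      rw [Real.sqrt_mul (by norm_num), show Real.sqrt 4 = 2 by
        rw [show (4 : ℝ) = 2 ^ 2 by norm_num, Real.sqrt_sq (by norm_num)]]]
    exact Real.sqrt_le_sqrt hT3N
  have hsT0 : 0 < Real.sqrt ((T : ℝ) - 3) := Real.sqrt_pos.2 hT3
  have hA : Real.pi * Real.sqrt (2 * N / 3) / N ≤ 2 * Real.pi * Real.sqrt (2 / 3) / Real.sqrt ((T : ℝ) - 3) := by
    rw [hsqrt, div_le_div_iff₀ (by linarith) hsT0]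
    have h0 : 0 ≤ Real.pi * Real.sqrt (2 / 3) := by positivity
    calc Real.pi * (Real.sqrt (2 / 3) * Real.sqrt N) * Real.sqrt ((T : ℝ) - 3)
        = (Real.pi * Real.sqrt (2 / 3)) * (Real.sqrt N * Real.sqrt ((T : ℝ) - 3)) := by ring
      _ ≤ (Real.pi * Real.sqrt (2 / 3)) * (Real.sqrt N * (2 * Real.sqrt N)) :=
          mul_le_mul_of_nonneg_left (mul_le_mul_of_nonneg_left hs1 hsN0.le) h0
      _ = 2 * Real.pi * Real.sqrt (2 / 3) * (Real.sqrt N * Real.sqrt N) := by ring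
      _ = 2 * Real.pi * Real.sqrt (2 / 3) * N := by rw [← hNsq]
  have hB : (Real.log μ + Real.log N + Real.log ((tubeOffsets d k N).card : ℝ)) / N ≤
      4 * (Real.log μ + ((d : ℝ) + 1) * Real.log T) / ((T : ℝ) - 3) := by
    rw [div_le_div_iff₀ (by linarith) hT3]
    have hnum : Real.log μ + Real.log N + Real.log ((tubeOffsets d k N).card : ℝ) ≤
        Real.log μ + ((d : ℝ) + 1) * Real.log T := by nlinarith
    have hnn : 0 ≤ Real.log μ + ((d : ℝ) + 1) * Real.log T := by positivity
    calc (Real.log μ + Real.log N + Real.log ((tubeOffsets d k N).card : ℝ)) * ((T : ℝ) - 3)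
        ≤ (Real.log μ + ((d : ℝ) + 1) * Real.log T) * ((T : ℝ) - 3) :=
          mul_le_mul_of_nonneg_right hnum hT3.le
      _ ≤ (Real.log μ + ((d : ℝ) + 1) * Real.log T) * (4 * N) := mul_le_mul_of_nonneg_left hT3N hnn
      _ = 4 * (Real.log μ + ((d : ℝ) + 1) * Real.log T) * N := by ring
  have hsplit : (Real.log μ + Real.pi * Real.sqrt (2 * N / 3) + Real.log N +
      Real.log ((tubeOffsets d k N).card : ℝ)) / N =
      Real.pi * Real.sqrt (2 * N / 3) / N +
        (Real.log μ + Real.log N + Real.log ((tubeOffsets d k N).card : ℝ)) / N := by ring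
  rw [hsplit] at hrate
  linarith

/-- **The planar strip `ℤ × {0,…,T}`** (`d = 2`, `k = 1`) with the sharp constant: for every `T ≥ 4`,
`log μ(ℤ²) - log μ(R[1,T]) ≤ 5.1303/√(T-3) + (8 log T + 4.8)/(T-3)` (using `#offsets = 2N+1 ≤ T`
and `log μ(ℤ²) ≤ log 3 ≤ 1.2`). [cite: MadrasSlade1993, Theorem 8.2.1, eq. (8.2.12); §3.1 eq. (3.1.7)] -/
theorem log_sub_log_stripConnectiveConstant_le_sharp {T : ℕ} (hT : 4 ≤ T) :
    Real.log (connectiveConstant 2) - Real.log (tubeConnectiveConstant 2 1 T) ≤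
      5.1303 / Real.sqrt ((T : ℝ) - 3) + (8 * Real.log T + 4.8) / ((T : ℝ) - 3) := by
  have hk : 1 ≤ 1 := le_rfl
  set μ := connectiveConstant 2 with hμdef
  have hμ1 : 1 ≤ μ := one_le_connectiveConstant 2
  have hμ3 : μ ≤ 3 := by
    have := connectiveConstant_le 2 (by norm_num)
    norm_num at this
    exact this
  have hlogμ : 0 ≤ Real.log μ := Real.log_nonneg hμ1
  have hlogμ' : Real.log μ ≤ 1.2 := by
    have h1 := Real.log_le_log (by linarith) hμ3
    have h2 : Real.log 3 = Real.log 2 + Real.log (3 / 2) := by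
      rw [← Real.log_mul (by norm_num) (by norm_num)]; norm_num
    have h3 : Real.log (3 / 2) ≤ 3 / 2 - 1 := Real.log_le_sub_one_of_pos (by norm_num)
    have h4 := Real.log_two_lt_d9
    linarith
  set N := T / 4 with hNdef
  have hN1 : 1 ≤ N := by omega
  have h4N : 4 * N ≤ T := by omega
  have hT43 : T ≤ 4 * N + 3 := by omega
  have hNr : (1 : ℝ) ≤ N := by exact_mod_cast hN1
  have hTr : (4 : ℝ) ≤ T := by exact_mod_cast hT
  have hT3 : (0 : ℝ) < (T : ℝ) - 3 := by linarith
  have hT3N : (T : ℝ) - 3 ≤ 4 * N := by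
    have : (T : ℝ) ≤ 4 * N + 3 := by exact_mod_cast hT43
    linarith
  have hNT : (N : ℝ) ≤ T := by exact_mod_cast (show N ≤ T by omega)
  have h2N1T : (2 * (N : ℝ) + 1) ≤ T := by exact_mod_cast (show 2 * N + 1 ≤ T by omega)
  have hmono' : Real.log (tubeConnectiveConstant 2 1 (4 * N)) ≤
      Real.log (tubeConnectiveConstant 2 1 T) :=
    Real.log_le_log (tubeConnectiveConstant_pos hk _) (tubeConnectiveConstant_mono 1 h4N)
  have hrate := log_sub_log_tubeConnectiveConstant_four_mul_le_sharp (d := 2) hk hN1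
  rw [card_tubeOffsets_two_one] at hrate
  have hsN0 : 0 < Real.sqrt N := Real.sqrt_pos.2 (by linarith)
  have hNsq : (N : ℝ) = Real.sqrt N * Real.sqrt N := (Real.mul_self_sqrt (by linarith)).symm
  have hsqrt : Real.sqrt (2 * N / 3) = Real.sqrt (2 / 3) * Real.sqrt N := by
    rw [← Real.sqrt_mul (by norm_num)]; congr 1; ring
  have hP : Real.log ((2 * N + 1 : ℕ) : ℝ) ≤ Real.log T := by
    push_cast; exact Real.log_le_log (by linarith) h2N1T
  have hlogN : Real.log N ≤ Real.log T := Real.log_le_log (by linarith) hNT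
  have hlogT : 0 ≤ Real.log T := Real.log_nonneg (by linarith)
  have hs1 : Real.sqrt ((T : ℝ) - 3) ≤ 2 * Real.sqrt N := by
    rw [show (2 : ℝ) * Real.sqrt N = Real.sqrt (4 * N) by
      rw [Real.sqrt_mul (by norm_num), show Real.sqrt 4 = 2 by
        rw [show (4 : ℝ) = 2 ^ 2 by norm_num, Real.sqrt_sq (by norm_num)]]]
    exact Real.sqrt_le_sqrt hT3N
  have hsT0 : 0 < Real.sqrt ((T : ℝ) - 3) := Real.sqrt_pos.2 hT3
  have hc := two_pi_sqrt_two_thirds_le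
  have hA : Real.pi * Real.sqrt (2 * N / 3) / N ≤ 5.1303 / Real.sqrt ((T : ℝ) - 3) := by
    rw [hsqrt, div_le_div_iff₀ (by linarith) hsT0]
    have h0 : 0 ≤ Real.pi * Real.sqrt (2 / 3) := by positivity
    calc Real.pi * (Real.sqrt (2 / 3) * Real.sqrt N) * Real.sqrt ((T : ℝ) - 3)
        = (Real.pi * Real.sqrt (2 / 3)) * (Real.sqrt N * Real.sqrt ((T : ℝ) - 3)) := by ring
      _ ≤ (Real.pi * Real.sqrt (2 / 3)) * (Real.sqrt N * (2 * Real.sqrt N)) :=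
          mul_le_mul_of_nonneg_left (mul_le_mul_of_nonneg_left hs1 hsN0.le) h0
      _ = 2 * Real.pi * Real.sqrt (2 / 3) * (Real.sqrt N * Real.sqrt N) := by ring
      _ = 2 * Real.pi * Real.sqrt (2 / 3) * N := by rw [← hNsq]
      _ ≤ 5.1303 * N := mul_le_mul_of_nonneg_right hc (by linarith)
  have hB : (Real.log μ + Real.log N + Real.log ((2 * N + 1 : ℕ) : ℝ)) / N ≤
      (8 * Real.log T + 4.8) / ((T : ℝ) - 3) := by
    rw [div_le_div_iff₀ (by linarith) hT3]
    have hnum : Real.log μ + Real.log N + Real.log ((2 * N + 1 : ℕ) : ℝ) ≤ 1.2 + 2 * Real.log T := by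
      linarith
    have hnn : (0 : ℝ) ≤ 1.2 + 2 * Real.log T := by positivity
    calc (Real.log μ + Real.log N + Real.log ((2 * N + 1 : ℕ) : ℝ)) * ((T : ℝ) - 3)
        ≤ (1.2 + 2 * Real.log T) * ((T : ℝ) - 3) := mul_le_mul_of_nonneg_right hnum hT3.le
      _ ≤ (1.2 + 2 * Real.log T) * (4 * N) := mul_le_mul_of_nonneg_left hT3N hnn
      _ = (8 * Real.log T + 4.8) * N := by ring
  have hsplit : (Real.log μ + Real.pi * Real.sqrt (2 * N / 3) + Real.log N +
      Real.log ((2 * N + 1 : ℕ) : ℝ)) / N =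
      Real.pi * Real.sqrt (2 * N / 3) / N +
        (Real.log μ + Real.log N + Real.log ((2 * N + 1 : ℕ) : ℝ)) / N := by ring
  rw [hsplit] at hrate
  linarith

/-- **The leading constant `2π√(2/3)`**: for every `η > 0`, for all sufficiently large `T`,
`log μ - log μ(R[k,T]) ≤ (2π√(2/3) + η)/√T`. [cite: MadrasSlade1993, Theorem 8.2.1, eq. (8.2.12); §3.1 eq. (3.1.7)] -/
theorem eventually_log_sub_log_tubeConnectiveConstant_le (hk : 1 ≤ k) {η : ℝ} (hη : 0 < η) :
    ∀ᶠ T : ℕ in atTop, Real.log (connectiveConstant d) - Real.log (tubeConnectiveConstant d k T) ≤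
      (2 * Real.pi * Real.sqrt (2 / 3) + η) / Real.sqrt T := by
  obtain ⟨c, hc⟩ : ∃ c : ℝ, c = 2 * Real.pi * Real.sqrt (2 / 3) := ⟨_, rfl⟩
  obtain ⟨A, hA⟩ : ∃ A : ℝ, A = Real.log (connectiveConstant d) := ⟨_, rfl⟩
  obtain ⟨D, hD⟩ : ∃ D : ℝ, D = (d : ℝ) + 1 := ⟨_, rfl⟩
  have hc0 : 0 ≤ c := by rw [hc]; positivity
  have hA0 : 0 ≤ A := by rw [hA]; exact Real.log_nonneg (one_le_connectiveConstant d)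
  have hD0 : 0 ≤ D := by rw [hD]; positivity
  -- the correction `g(T) = 6c/T + 8A/√T + 8D log T/√T → 0`
  have hnat : Tendsto (fun T : ℕ => (T : ℝ)) atTop atTop := tendsto_natCast_atTop_atTop
  have h1 : Tendsto (fun T : ℕ => 6 * c / (T : ℝ)) atTop (𝓝 0) := by
    have h := (tendsto_inv_atTop_zero.comp hnat).const_mul (6 * c)
    rw [mul_zero] at h
    exact h.congr fun T => by simp [div_eq_mul_inv]
  have hsqrt : Tendsto (fun T : ℕ => Real.sqrt (T : ℝ)) atTop atTop := Real.tendsto_sqrt_atTop.comp hnat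
  have h2 : Tendsto (fun T : ℕ => 8 * A / Real.sqrt (T : ℝ)) atTop (𝓝 0) := by
    have h := (tendsto_inv_atTop_zero.comp hsqrt).const_mul (8 * A)
    rw [mul_zero] at h
    exact h.congr fun T => by simp [div_eq_mul_inv]
  have h3 : Tendsto (fun T : ℕ => 8 * D * (Real.log (T : ℝ) / Real.sqrt (T : ℝ))) atTop (𝓝 0) := by
    have hlo := (isLittleO_log_rpow_atTop (by norm_num : (0 : ℝ) < 1 / 2)).tendsto_div_nhds_zero
    have hlo' : Tendsto (fun x : ℝ => Real.log x / Real.sqrt x) atTop (𝓝 0) := by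
      refine hlo.congr' ?_
      filter_upwards [eventually_ge_atTop 0] with x hx
      rw [Real.sqrt_eq_rpow]
    simpa using (hlo'.comp hnat).const_mul (8 * D)
  have hsum : Tendsto (fun T : ℕ => 6 * c / (T : ℝ) + 8 * A / Real.sqrt (T : ℝ) +
      8 * D * (Real.log (T : ℝ) / Real.sqrt (T : ℝ))) atTop (𝓝 0) := by
    simpa using (h1.add h2).add h3
  have hev := hsum.eventually (Iio_mem_nhds hη)
  filter_upwards [hev, eventually_ge_atTop 6] with T hg hT6
  have hg : 6 * c / (T : ℝ) + 8 * A / Real.sqrt (T : ℝ) +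
      8 * D * (Real.log (T : ℝ) / Real.sqrt (T : ℝ)) < η := hg
  have hmain := log_sub_log_tubeConnectiveConstant_le_sharp (d := d) hk (show 4 ≤ T by omega)
  rw [← hc, ← hA, ← hD] at hmain
  rw [← hc]
  have hTr : (6 : ℝ) ≤ T := by exact_mod_cast hT6
  have hT3 : (0 : ℝ) < (T : ℝ) - 3 := by linarith
  have hsT3 : 0 < Real.sqrt ((T : ℝ) - 3) := Real.sqrt_pos.2 hT3
  have hT3sq : Real.sqrt ((T : ℝ) - 3) * Real.sqrt ((T : ℝ) - 3) = (T : ℝ) - 3 :=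
    Real.mul_self_sqrt hT3.le
  have hle3 : Real.sqrt ((T : ℝ) - 3) ≤ Real.sqrt (T : ℝ) := Real.sqrt_le_sqrt (by linarith)
  have hL0 : 0 ≤ Real.log (T : ℝ) := Real.log_nonneg (by linarith)
  -- substitute `s = √T`, `L = log T`: everything is rational in `s`
  set s := Real.sqrt (T : ℝ) with hsdef
  set L := Real.log (T : ℝ) with hLdef
  have hsT : 0 < s := Real.sqrt_pos.2 (by linarith)
  have hs2 : (T : ℝ) = s * s := (Real.mul_self_sqrt (by linarith : (0 : ℝ) ≤ T)).symm
  have hs6 : 6 ≤ s * s := by rw [← hs2]; exact hTr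
  have hss3 : 0 < s * s - 3 := by linarith
  -- `c/√(T-3) ≤ c s/(s² - 3)` since `√(T-3) ≤ √T = s`
  have hterm1 : c / Real.sqrt ((T : ℝ) - 3) ≤ c * s / (s * s - 3) := by
    rw [div_le_div_iff₀ hsT3 hss3]
    calc c * (s * s - 3) = c * (Real.sqrt ((T : ℝ) - 3) * Real.sqrt ((T : ℝ) - 3)) := by
          rw [hT3sq, hs2]
      _ ≤ c * (s * Real.sqrt ((T : ℝ) - 3)) :=
          mul_le_mul_of_nonneg_left (mul_le_mul_of_nonneg_right hle3 hsT3.le) hc0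
      _ = c * s * Real.sqrt ((T : ℝ) - 3) := by ring
  have hterm2 : 4 * (A + D * L) / ((T : ℝ) - 3) = 4 * (A + D * L) / (s * s - 3) := by rw [hs2]
  have hsum' : c * s / (s * s - 3) + 4 * (A + D * L) / (s * s - 3) =
      (c * s + 4 * (A + D * L)) / (s * s - 3) := by ring
  -- the polynomial inequality `(c s + 4(A + D L)) s³ ≤ (c s² + 6c + 8A s + 8DL s)(s² - 3)` for `s² ≥ 6`
  have hpoly : (c * s + 4 * (A + D * L)) / (s * s - 3) ≤
      (c * (s * s) + 6 * c + 8 * A * s + 8 * D * L * s) / (s * s * s) := by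
    rw [div_le_div_iff₀ hss3 (by positivity)]
    have hkey : 0 ≤ (s * s - 6) * (3 * c + 4 * A * s + 4 * D * L * s) :=
      mul_nonneg (by linarith) (by positivity)
    nlinarith [hkey]
  have hrhs : (c * (s * s) + 6 * c + 8 * A * s + 8 * D * L * s) / (s * s * s) =
      (c + (6 * c / (s * s) + 8 * A / s + 8 * D * (L / s))) / s := by
    field_simp
    ring
  have hg' : (c + (6 * c / (s * s) + 8 * A / s + 8 * D * (L / s))) / s ≤ (c + η) / s := by
    rw [hs2] at hg
    exact div_le_div_of_nonneg_right (by linarith [hg.le]) hsT.le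
  linarith [hmain, hterm1, hterm2.le, hterm2.ge, hsum'.le, hsum'.ge, hpoly, hrhs.le, hrhs.ge, hg']

end Rate

end Literature.Probability.RandomPlanarGeometry.SAW.Zd
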